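import Summits.QuantumFields.BalabanUV.T4Continuum.Spine.NE1p.DressedSmallFieldOnCoresSlotLetters
import Summits.QuantumFields.BalabanUV.T4Continuum.Support.B13TermCoreMass

/-!
# T⁴ programme, spine estimate NE1′ (node O3b/H2) — (B3) FOR THE SLOT OF RECORD IN ROW NE5's `factorMass` CURRENCY: S30's letter budget
# `hM3` on the explicit letters is AT MOST the sum of row NE5's FACTOR MASS LETTERS `B13TermCoreMass.factorMass` of the cores of record at
# a uniform margin floor `m⋆` — ONE currency for the cross-row datum G-ne9p2-5 on rows NE1′ and NE5, in kernel

Cell `pub-balaban`, sub-cell `t4`, BINDER-OWNERS row NE1′ (owner lineage t4-ne1p-p1); crew seat `b2b-balaban-t4-ne1p-formalise-leaf-01` (LEAF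
PROVER 01, gen 12); crew row S32 ∕ DAG N29zza (INTENT `CLAIMS.log` 2026-08-20T17:26:52Z; typer R-T122 (i), X143).  ADDITIVE — imports crew row S30
`Spine/NE1p/DressedSmallFieldOnCoresSlotLetters` (p228879; ⇒ N0r p228506 ⇒ N0q ⇒ N0p; ⇒ the substrate's `SubstrateSlotsOfRecord` ∕
`SubstrateGaussianLettersBall`) and row NE5's `Support/B13TermCoreMass` (p218343, NE5 leaf-08; `factorMass`) ONLY; THEOREMS ONLY (0 `def`, 0 `def … : Prop`, 0 cite); nothing of S30 ∕ N0p–N0r ∕ row NE5 ∕ the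
substrate restated — used BY NAME.

WHY THIS FILE.  The owner's N0q says (B3) = G-ne9p2-5 should be «named in ONE currency on both rows» and points at row NE5's
`paramMass` ∕ `factorMass`.  After S30 the (B3) binder of the slot END at the core letters of record reads, per polymer `Z` inside `X₀`,
`Σ_{p ∈ terms Z} λ_p(univ)·(wB_p·N₀f p·e^{0})·(π∕(mq k p∕2))^{dim V_p∕2}·e^{N₁,p·R₀} ≤ (A₀ + ϱA₁)·e^{−R dj Z}` with the EXPLICIT letters
`N₀f p = gaussC·√(max 1 (card!·β₀^card + d₀))`, `mq k p = (γ − card·ϑ·R′ k)∕2`.  Row NE5's FACTOR MASS LETTER is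
`factorMass 𝔠 N₀f bf m⋆ H Z j = λ_{Zj}(univ)·wB_{Zj}·N₀f Z j·e^{N₁,Zj·H + bf Z j}·(2π∕m⋆)^{dim V_{Zj}∕2}` (`B13TermCoreMass` §2).  Since
`π∕(mq∕2) = 2π∕mq ≤ 2π∕m⋆` for a uniform margin floor `0 < m⋆ ≤ mq k p`, each S30 summand is AT MOST `factorMass (coreOf (coreLettersOf A))
N₀f 0 m⋆ R₀ Z′ j` — so S30's ENDs hold under the (2.38)-shape budget stated on row NE5's letters:
* §1 (kernel) `letterMass_le_factorMass` — one core: the S30 summand `≤ factorMass … m⋆ R₀` (`div_le_div_of_nonneg_left` + `Real.rpow_le_rpow`);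
  `sum_letterMass_le_sum_factorMass` — summed over `terms Z`.
* §2 (kernel) **`attachedPart_locE_le_of_coreLettersOf_factorMass`** ∕ **`muPart_locE_le_of_coreLettersOf_factorMass`** — S30 §2's two ENDs
  ONCE BY NAME each with `hM3` SUPPLIED from **`hF3 : Σ_{p ∈ terms Z} factorMass (fun Z j => coreOf … (coreLettersOf A) Z j) N₀f 0 m⋆ R₀ p.1 p.2
  ≤ (A₀ + ϱA₁)·e^{−R dj Z}`** (`R₀ = ‖h₀‖ + ϱ‖w‖`, resp. `μ₁‖v‖`, budget `A'` for the μ-part) and the margin smallness `hmq` REPLACED by the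
  floor `hm⋆ : 0 < m⋆`, `hfloor : m⋆ ≤ (γ Z j − card·ϑ Z j·R′ k)∕2` (which implies `hmq`); every other binder VERBATIM S30's.
  CENSUS vs S30 §2: MINUS = [`hmq`, `hM3`]; PLUS = [`m⋆`, `hm⋆`, `hfloor`, `hF3`]; rest IDENTICAL; conclusions LITERALLY S30's = N0r's.

WHAT IT SAYS (wording offered for the typer): «for the substrate's slot of record, (B3) = G-ne9p2-5 is implied by ONE (2.38)-shape inequality
per polymer on row NE5's FACTOR MASS LETTERS `factorMass` of the cores of record (parameter volume × Cauchy-weight letter × Gaussian letter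
`N₀f` × read-out growth `e^{N₁R₀}` × Gaussian volume `(2π∕m⋆)^{dim∕2}`) — the SAME letters row NE5's END of record budgets
(`paramMass_termCore_le_actMajorant`, p223680's `hdec`); the datum is thereby named in one currency on both rows, NOT discharged: where
(2.38)'s decay `e^{−R dj Z}` comes from (the cube letters' `e^{−(κ₁−1)}` — crew W34's mechanism) stays DISPLAYED in `hF3`; 0 binders
instantiated on Bałaban's densities; no numeral of print; no wall item discharged; wall v1.7 (T4-DAG v43) does NOT move; R-t4r2-Q2 NOT met; NE1′ NOT proved».  TYPER RIDER
(R-T122 (i)(g), verbatim): «the floor `m⋆` and the comparison letter-mass ≤ factor-mass are OUR arithmetic on displayed letter SHAPES; (B3) is thereby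
NAMED for the substrate's slot of record in NE5's factor currency in kernel — NOT discharged (G-ne9p2-5 UNPRINTED, shared with NE9); `hF3` is a hypothesis
SHAPE of (2.38) TYPE whose decay source stays DISPLAYED; 0 binders instantiated on Bałaban's densities; wall v1.7 (T4-DAG v43) does NOT move».

HONEST FRAMING.  Arithmetic on displayed letter SHAPES + by-name composition; 0 estimates of print; ABSOLUTE RULE honoured.  Rung (B)+1 on ONE
finite four-torus — NOT infinite volume, NOT a mass gap, NOT OS on ℝ⁴, NOT Clay.  HONEST DEPENDENCY: continuum YM on T⁴ ⇐ BetaPertH ∧ nine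
spine estimates (0/9 proved); BetaPertH ⇐ (D1) ∧ (D4) ∧ CAP+tail; G-an2-4 gates asym, D1 and NE2/3/4. -/

noncomputable section

namespace Summit.QuantumFields.BalabanUV.T4Continuum.NE1p.DressedSmallFieldOnCoresSlotLettersMass

open scoped BigOperators Matrix
open Metric Set MeasureTheory
open Literature.MathematicalPhysics.QuantumFieldTheory.Balaban1983to89
open Literature.MathematicalPhysics.QuantumFieldTheory.Balaban1983to89.B13Resummation (locE Geometry)
open Literature.MathematicalPhysics.QuantumFieldTheory.Balaban1983to89.B5Prop11Lower (nsq)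
open Literature.MathematicalPhysics.QuantumFieldTheory.Balaban1983to89.T4OutputRate (Carriers)
open Summit.QuantumFields.BalabanUV.T4Continuum.B13HistMeasurable (MeasPotFrame B13HistM)
open Summit.QuantumFields.BalabanUV.T4Continuum.B13TermParamGaussianBi (BiCore)
open Summit.QuantumFields.BalabanUV.T4Continuum.B13TermCoreMass (factorMass)
open Summit.QuantumFields.BalabanUV.T4Continuum.SubstrateTwoRunsDriven (DrivenRuns)
open Summit.QuantumFields.BalabanUV.T4Continuum.SubstrateActivities (coreOf actOfLetters)
open Summit.QuantumFields.BalabanUV.T4Continuum.SubstrateGaussianLetters (gaussC gaussC_pos linForm)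
open Summit.QuantumFields.BalabanUV.T4Continuum.SubstrateGaussianLettersBall (detBudget)
open Summit.QuantumFields.BalabanUV.T4Continuum.SubstrateSlotsOfRecord (ActLetters coreLettersOf)
open Summit.QuantumFields.BalabanUV.T4Continuum.NE1p.DressedSmallFieldOnCoresSlotLetters (attachedPart_locE_le_of_coreLettersOf
  muPart_locE_le_of_coreLettersOf)

/-! ## §1 One core: the S30 letter summand is at most row NE5's factor mass letter at a margin floor -/

section OneCore

variable {C : Carriers} {P : MeasPotFrame C} {Pol J : Type*} {𝒴 : Pol → J → Type*} {dom : ∀ Z j, 𝒴 Z j → C.Dom} {Op : Type*}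
  {PΛ : Pol → J → Type*} {V : Pol → J → Type*} [∀ Z j, MeasurableSpace (PΛ Z j)] [∀ Z j, NormedAddCommGroup (V Z j)]
  [∀ Z j, InnerProductSpace ℝ (V Z j)] [∀ Z j, MeasurableSpace (V Z j)]
  (𝔠 : ∀ Z j, BiCore P (dom Z j) Op (PΛ Z j) (V Z j))

/-- **THE LETTER SUMMAND IS AT MOST THE FACTOR MASS LETTER** (kernel arithmetic): for a margin floor `0 < m⋆ ≤ mq`, nonnegative `wB` and
`N₀`, `λ(univ)·(wB·N₀·e^{0})·(π∕(mq∕2))^{dim∕2}·e^{N₁R₀} ≤ factorMass 𝔠 N₀f 0 m⋆ R₀ Z j` (`π∕(mq∕2) = 2π∕mq ≤ 2π∕m⋆`, `Real.rpow_le_rpow`).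
[folklore] -/
theorem letterMass_le_factorMass {N₀f : Pol → J → ℝ} {mstar mq R₀ : ℝ} (Z : Pol) (j : J) (hm : 0 < mstar) (hmq : mstar ≤ mq)
    (hwB : 0 ≤ (𝔠 Z j).wB) (hN₀ : 0 ≤ N₀f Z j) :
    (𝔠 Z j).lam.real univ * ((𝔠 Z j).wB * N₀f Z j * Real.exp 0) * (Real.pi / (mq / 2)) ^ (Module.finrank ℝ (V Z j) / 2 : ℝ) *
        Real.exp ((𝔠 Z j).N₁ * R₀) ≤
      factorMass 𝔠 N₀f (fun _ _ => 0) mstar R₀ Z j := by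
  have hmq0 : 0 < mq := hm.trans_le hmq
  have hbase : Real.pi / (mq / 2) ≤ 2 * Real.pi / mstar := by
    rw [div_div_eq_mul_div, mul_comm]
    exact div_le_div_of_nonneg_left (by positivity) hm hmq
  have hG : (Real.pi / (mq / 2)) ^ (Module.finrank ℝ (V Z j) / 2 : ℝ) ≤ (2 * Real.pi / mstar) ^ (Module.finrank ℝ (V Z j) / 2 : ℝ) :=
    Real.rpow_le_rpow (by positivity) hbase (by positivity)
  have hK : 0 ≤ (𝔠 Z j).lam.real univ * (𝔠 Z j).wB * N₀f Z j * Real.exp ((𝔠 Z j).N₁ * R₀) :=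
    mul_nonneg (mul_nonneg (mul_nonneg measureReal_nonneg hwB) hN₀) (Real.exp_nonneg _)
  unfold factorMass
  rw [Real.exp_zero, mul_one, add_zero]
  calc (𝔠 Z j).lam.real univ * ((𝔠 Z j).wB * N₀f Z j) * (Real.pi / (mq / 2)) ^ (Module.finrank ℝ (V Z j) / 2 : ℝ) *
        Real.exp ((𝔠 Z j).N₁ * R₀)
      = (𝔠 Z j).lam.real univ * (𝔠 Z j).wB * N₀f Z j * Real.exp ((𝔠 Z j).N₁ * R₀) *
          (Real.pi / (mq / 2)) ^ (Module.finrank ℝ (V Z j) / 2 : ℝ) := by ring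
    _ ≤ (𝔠 Z j).lam.real univ * (𝔠 Z j).wB * N₀f Z j * Real.exp ((𝔠 Z j).N₁ * R₀) *
          (2 * Real.pi / mstar) ^ (Module.finrank ℝ (V Z j) / 2 : ℝ) := mul_le_mul_of_nonneg_left hG hK

/-- the same summed over the terms of a polymer, at a level-dependent margin letter `mq k p` bounded below by the floor. [folklore] -/
theorem sum_letterMass_le_sum_factorMass {N₀f : Pol → J → ℝ} {mstar R₀ : ℝ} {mq : Pol × J → ℝ} (terms : Finset (Pol × J))
    (hm : 0 < mstar) (hmq : ∀ p ∈ terms, mstar ≤ mq p) (hwB : ∀ Z j, 0 ≤ (𝔠 Z j).wB) (hN₀ : ∀ Z j, 0 ≤ N₀f Z j) :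
    ∑ p ∈ terms, (𝔠 p.1 p.2).lam.real univ * ((𝔠 p.1 p.2).wB * N₀f p.1 p.2 * Real.exp 0) *
        (Real.pi / (mq p / 2)) ^ (Module.finrank ℝ (V p.1 p.2) / 2 : ℝ) * Real.exp ((𝔠 p.1 p.2).N₁ * R₀) ≤
      ∑ p ∈ terms, factorMass 𝔠 N₀f (fun _ _ => 0) mstar R₀ p.1 p.2 :=
  Finset.sum_le_sum fun p hp => letterMass_le_factorMass 𝔠 p.1 p.2 hm (hmq p hp) (hwB p.1 p.2) (hN₀ p.1 p.2)

end OneCore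

/-! ## §2 S30's two slot ENDs at `coreLettersOf A` with (B3) supplied from a `factorMass` budget -/

section Ends

variable {G : Type} [GaugeGroup G] (D : DrivenRuns G) (P : MeasPotFrame D.carriers)
variable (Op : Type) [NormedAddCommGroup Op] [NormedSpace ℂ Op] {J : Type}
  (𝒵 : D.carriers.Dom → J → Type) [∀ Z j, Fintype (𝒵 Z j)] (dom : ∀ Z j, 𝒵 Z j → D.carriers.Dom)
  (Jc : D.carriers.Dom → J → Type) [∀ Z j, Fintype (Jc Z j)]
  (V : D.carriers.Dom → J → Type) [∀ Z j, NormedAddCommGroup (V Z j)] [∀ Z j, InnerProductSpace ℝ (V Z j)]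
  [∀ Z j, MeasurableSpace (V Z j)] [∀ Z j, BorelSpace (V Z j)] [∀ Z j, FiniteDimensional ℝ (V Z j)]
  (mI : D.carriers.Dom → J → Type) [∀ Z j, Fintype (mI Z j)] [∀ Z j, DecidableEq (mI Z j)]
variable (𝔇 : LocDomainSys) {Cube : Type} [DecidableEq Cube] (Ge : Geometry 𝔇 Cube)

open Classical in
/-- **THE ATTACHED PART OF THE SLOT ACTIVITIES AT THE CORE LETTERS OF RECORD, (B3) IN ROW NE5's `factorMass` CURRENCY** (kernel; S30 §2
`attachedPart_locE_le_of_coreLettersOf` ONCE BY NAME; its `hM3` SUPPLIED by §1 from `hF3`, its `hmq` from the margin floor `hm⋆`∕`hfloor`).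
Binders: S30's VERBATIM except `hmq ↦ (m⋆, hm⋆, hfloor)` and `hM3 ↦ hF3`; conclusion LITERALLY S30's = N0r's. [folklore] -/
theorem attachedPart_locE_le_of_coreLettersOf_factorMass {W : Set (ℕ → ℝ)} {ctr : ℕ → (ℕ → ℝ) → D.carriers.BgB → Op × B13HistM P}
    {ROp RHist R' : ℕ → ℝ} (A : ∀ Z j, ActLetters D P Op 𝒵 dom Jc V mI Z j) {β₀ ϑ d₀ γ : D.carriers.Dom → J → ℝ} {mstar : ℝ}
    (hroom : ∀ k, ROp k < R' k) (hR' : ∀ k, 0 ≤ R' k)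
    (hbase : ∀ Z j ii jj, Measurable fun a => (A Z j).base a ii jj)
    (hrdm : ∀ Z j ii jj (o' : Op), Measurable fun a => (A Z j).rd a ii jj o')
    (hβ₀ : ∀ Z j, 0 ≤ β₀ Z j) (hd₀ : ∀ Z j, 0 < d₀ Z j)
    (hrd : ∀ Z j a ii jj, ‖(A Z j).rd a ii jj‖ ≤ ϑ Z j)
    (hctr : ∀ k, ∀ g ∈ W, ∀ (U : D.carriers.BgB) (Z : D.carriers.Dom) (j : J) (a : (Jc Z j ⊕ 𝒵 Z j) → ℝ × ℝ),
      (∀ ii jj, ‖linForm (A Z j).base (A Z j).rd (ctr k g U).1 a ii jj‖ ≤ β₀ Z j) ∧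
      ((linForm (A Z j).base (A Z j).rd (ctr k g U).1 a).det).im = 0 ∧ d₀ Z j ≤ ((linForm (A Z j).base (A Z j).rd (ctr k g U).1 a).det).re ∧
      (∀ x : mI Z j → ℂ, γ Z j * nsq x ≤ (star x ⬝ᵥ (linForm (A Z j).base (A Z j).rd (ctr k g U).1 a *ᵥ x)).re))
    (hbud : ∀ k Z j, detBudget (Fintype.card (mI Z j)) (β₀ Z j) (ϑ Z j) (R' k) < d₀ Z j)
    -- the uniform margin floor (replaces S30's `hmq`)
    (hmstar : 0 < mstar) (hfloor : ∀ k Z j, mstar ≤ (γ Z j - Fintype.card (mI Z j) * ϑ Z j * R' k) / 2)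
    {k : ℕ} {g : ℕ → ℝ} (hg : g ∈ W) {U : D.carriers.BgB} {o : Op} {h₀ w : B13HistM P} {ϱ : ℝ}
    (hO : ‖o - (ctr k g U).1‖ ≤ ROp k) (hH : ‖h₀ - (ctr k g U).2‖ + ϱ * ‖w‖ ≤ RHist k)
    {emb : 𝔇.Dom → D.carriers.Dom} (hscale : ∀ Z, D.carriers.scale (emb Z) = k)
    (terms : 𝔇.Dom → Finset (D.carriers.Dom × J))
    {A₀ A₁ R r₁ b₅ : ℝ} {X₀ : 𝔇.Dom} (hA₀ : 0 ≤ A₀) (hA₁ : 0 ≤ A₁) (hr₁ : 0 ≤ r₁) (hb : r₁ * 5 ≤ b₅)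
    (hrate : r₁ + 2 * Ge.κ₀ + 2 ≤ R) (hsmall : (A₀ + ϱ * A₁) * Real.exp (b₅ + 1) * Ge.K₀ * Ge.ν * Ge.c₁ ≤ 1)
    -- (B3) as ONE (2.38)-shape inequality per polymer on row NE5's factor mass letters of the cores of record
    (hF3 : ∀ Z, Ge.cubes Z ⊆ Ge.cubes X₀ →
      ∑ p ∈ terms Z, factorMass (fun Z j => coreOf P Op 𝒵 dom Jc V (coreLettersOf D P Op 𝒵 dom Jc V mI A) Z j)
          (fun Z j => gaussC (mI Z j) * Real.sqrt (max 1 ((Fintype.card (mI Z j)).factorial * β₀ Z j ^ Fintype.card (mI Z j) + d₀ Z j)))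
          (fun _ _ => 0) mstar (‖h₀‖ + ϱ * ‖w‖) p.1 p.2 ≤ (A₀ + ϱ * A₁) * Real.exp (-(R * 𝔇.dj Z)))
    (hϱ : 2 ≤ ϱ) (hϱA : A₀ ≤ ϱ * A₁) :
    ‖locE Ge.ι Ge.cubes (fun Z => ∑ p ∈ terms Z,
          actOfLetters P Op 𝒵 dom Jc V (coreLettersOf D P Op 𝒵 dom Jc V mI A) p.1 p.2 o (h₀ + w)) (Ge.cubes X₀) -
        locE Ge.ι Ge.cubes (fun Z => ∑ p ∈ terms Z,
          actOfLetters P Op 𝒵 dom Jc V (coreLettersOf D P Op 𝒵 dom Jc V mI A) p.1 p.2 o h₀) (Ge.cubes X₀)‖ ≤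
      4 * (Real.exp 1 * Ge.ν * Ge.c₁ * Ge.K₀ ^ 2) * A₁ * Real.exp (-(r₁ * 𝔇.dj X₀)) :=
  attachedPart_locE_le_of_coreLettersOf D P Op 𝒵 dom Jc V mI 𝔇 Ge A hroom hR' hbase hrdm hβ₀ hd₀ hrd hctr hbud
    (fun k Z j => by have h := hfloor k Z j; linarith) hg hO hH hscale terms hA₀ hA₁ hr₁ hb hrate hsmall
    (fun Z hZ => le_trans (sum_letterMass_le_sum_factorMass
      (fun Z j => coreOf P Op 𝒵 dom Jc V (coreLettersOf D P Op 𝒵 dom Jc V mI A) Z j)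
      (N₀f := fun Z j => gaussC (mI Z j) * Real.sqrt (max 1 ((Fintype.card (mI Z j)).factorial * β₀ Z j ^ Fintype.card (mI Z j) + d₀ Z j)))
      (R₀ := ‖h₀‖ + ϱ * ‖w‖) (mq := fun p => (γ p.1 p.2 - Fintype.card (mI p.1 p.2) * ϑ p.1 p.2 * R' k) / 2) (terms Z) hmstar
      (fun p _ => hfloor k p.1 p.2)
      (fun Z j => (norm_nonneg _).trans ((coreOf P Op 𝒵 dom Jc V (coreLettersOf D P Op 𝒵 dom Jc V mI A) Z j).norm_w_le fun _ => (0, 0)))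
      (fun Z j => mul_nonneg gaussC_pos.le (Real.sqrt_nonneg _))) (hF3 Z hZ))
    hϱ hϱA

open Classical in
/-- **THE μ-PART OF THE SAME, (B3) IN `factorMass` CURRENCY** (kernel; S30 §2 `muPart_locE_le_of_coreLettersOf` ONCE BY NAME, `hM3` from `hF3`
at the history radius `‖h₀‖ + μ₁‖v‖` and budget `A'`, `hmq` from the floor). [folklore] -/
theorem muPart_locE_le_of_coreLettersOf_factorMass {W : Set (ℕ → ℝ)} {ctr : ℕ → (ℕ → ℝ) → D.carriers.BgB → Op × B13HistM P}
    {ROp RHist R' : ℕ → ℝ} (A : ∀ Z j, ActLetters D P Op 𝒵 dom Jc V mI Z j) {β₀ ϑ d₀ γ : D.carriers.Dom → J → ℝ} {mstar : ℝ}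
    (hroom : ∀ k, ROp k < R' k) (hR' : ∀ k, 0 ≤ R' k)
    (hbase : ∀ Z j ii jj, Measurable fun a => (A Z j).base a ii jj)
    (hrdm : ∀ Z j ii jj (o' : Op), Measurable fun a => (A Z j).rd a ii jj o')
    (hβ₀ : ∀ Z j, 0 ≤ β₀ Z j) (hd₀ : ∀ Z j, 0 < d₀ Z j)
    (hrd : ∀ Z j a ii jj, ‖(A Z j).rd a ii jj‖ ≤ ϑ Z j)
    (hctr : ∀ k, ∀ g ∈ W, ∀ (U : D.carriers.BgB) (Z : D.carriers.Dom) (j : J) (a : (Jc Z j ⊕ 𝒵 Z j) → ℝ × ℝ),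
      (∀ ii jj, ‖linForm (A Z j).base (A Z j).rd (ctr k g U).1 a ii jj‖ ≤ β₀ Z j) ∧
      ((linForm (A Z j).base (A Z j).rd (ctr k g U).1 a).det).im = 0 ∧ d₀ Z j ≤ ((linForm (A Z j).base (A Z j).rd (ctr k g U).1 a).det).re ∧
      (∀ x : mI Z j → ℂ, γ Z j * nsq x ≤ (star x ⬝ᵥ (linForm (A Z j).base (A Z j).rd (ctr k g U).1 a *ᵥ x)).re))
    (hbud : ∀ k Z j, detBudget (Fintype.card (mI Z j)) (β₀ Z j) (ϑ Z j) (R' k) < d₀ Z j)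
    (hmstar : 0 < mstar) (hfloor : ∀ k Z j, mstar ≤ (γ Z j - Fintype.card (mI Z j) * ϑ Z j * R' k) / 2)
    {k : ℕ} {g : ℕ → ℝ} (hg : g ∈ W) {U : D.carriers.BgB} {o : Op} {h₀ v : B13HistM P} {μ₁ : ℝ}
    (hO : ‖o - (ctr k g U).1‖ ≤ ROp k) (hH : ‖h₀ - (ctr k g U).2‖ + μ₁ * ‖v‖ ≤ RHist k)
    {emb : 𝔇.Dom → D.carriers.Dom} (hscale : ∀ Z, D.carriers.scale (emb Z) = k)
    (terms : 𝔇.Dom → Finset (D.carriers.Dom × J))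
    {A' R r₁ b₅ μ₀ : ℝ} {X₀ : 𝔇.Dom} {sμ : ℂ} (hA : 0 ≤ A') (hr₁ : 0 ≤ r₁) (hb : r₁ * 5 ≤ b₅)
    (hrate : r₁ + 2 * Ge.κ₀ + 2 ≤ R) (hsmall : A' * Real.exp (b₅ + 1) * Ge.K₀ * Ge.ν * Ge.c₁ ≤ 1)
    (hF3 : ∀ Z, Ge.cubes Z ⊆ Ge.cubes X₀ →
      ∑ p ∈ terms Z, factorMass (fun Z j => coreOf P Op 𝒵 dom Jc V (coreLettersOf D P Op 𝒵 dom Jc V mI A) Z j)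
          (fun Z j => gaussC (mI Z j) * Real.sqrt (max 1 ((Fintype.card (mI Z j)).factorial * β₀ Z j ^ Fintype.card (mI Z j) + d₀ Z j)))
          (fun _ _ => 0) mstar (‖h₀‖ + μ₁ * ‖v‖) p.1 p.2 ≤ A' * Real.exp (-(R * 𝔇.dj Z)))
    (h0 : 0 < μ₀) (h01 : μ₀ < μ₁) (hμ : ‖sμ‖ ≤ μ₀) :
    ‖locE Ge.ι Ge.cubes (fun Z => ∑ p ∈ terms Z,
          actOfLetters P Op 𝒵 dom Jc V (coreLettersOf D P Op 𝒵 dom Jc V mI A) p.1 p.2 o (h₀ + sμ • v)) (Ge.cubes X₀) -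
        locE Ge.ι Ge.cubes (fun Z => ∑ p ∈ terms Z,
          actOfLetters P Op 𝒵 dom Jc V (coreLettersOf D P Op 𝒵 dom Jc V mI A) p.1 p.2 o h₀) (Ge.cubes X₀)‖ ≤
      Real.exp 1 * Ge.ν * Ge.c₁ * Ge.K₀ ^ 2 * A' * Real.exp (-(r₁ * 𝔇.dj X₀)) * (μ₀ / (μ₁ - μ₀)) :=
  muPart_locE_le_of_coreLettersOf D P Op 𝒵 dom Jc V mI 𝔇 Ge A hroom hR' hbase hrdm hβ₀ hd₀ hrd hctr hbud
    (fun k Z j => by have h := hfloor k Z j; linarith) hg hO hH hscale terms hA hr₁ hb hrate hsmall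
    (fun Z hZ => le_trans (sum_letterMass_le_sum_factorMass
      (fun Z j => coreOf P Op 𝒵 dom Jc V (coreLettersOf D P Op 𝒵 dom Jc V mI A) Z j)
      (N₀f := fun Z j => gaussC (mI Z j) * Real.sqrt (max 1 ((Fintype.card (mI Z j)).factorial * β₀ Z j ^ Fintype.card (mI Z j) + d₀ Z j)))
      (R₀ := ‖h₀‖ + μ₁ * ‖v‖) (mq := fun p => (γ p.1 p.2 - Fintype.card (mI p.1 p.2) * ϑ p.1 p.2 * R' k) / 2) (terms Z) hmstar
      (fun p _ => hfloor k p.1 p.2)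
      (fun Z j => (norm_nonneg _).trans ((coreOf P Op 𝒵 dom Jc V (coreLettersOf D P Op 𝒵 dom Jc V mI A) Z j).norm_w_le fun _ => (0, 0)))
      (fun Z j => mul_nonneg gaussC_pos.le (Real.sqrt_nonneg _))) (hF3 Z hZ))
    h0 h01 hμ

end Ends

end Summit.QuantumFields.BalabanUV.T4Continuum.NE1p.DressedSmallFieldOnCoresSlotLettersMass

end
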